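import Literature.NumberTheory.EllipticCurves.ZpExtensionEisensteinH3OrdinaryProofs
import Literature.NumberTheory.EllipticCurves.ZpExtensionEisensteinTwistedFilCoordinatesProofs
import Literature.NumberTheory.GaloisCohomology.Howard2004.PrincipalArtinianDivisibilityProofs
import HarnessLib

/-!
# The plus parts of the `π`-adic levels of the curve's Eisenstein tower at a place above `p`: (map), (ONTO), (SAT)
# for the two-index family `T/π^aT → T/π^bT` (theorems only; no definition, no named fact, no instance, no `sorry`)

Topic `NumberTheory/EllipticCurves` (D1 road of cell `pub/bsd-print-x9`, brick (H5B-P-ANOM) of `Stmt.h5bAtS`, road «uniform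
involution» (seat `bsd-line-x9-p1-w3` g6, file F3 of the design): the MODULE-LEVEL inputs of the presented sub/quotient
`π`-adic towers at a place `v ∣ p`).

B. Howard, *The Heegner point Kolyvagin system*, Compositio Math. 140 (2004) (arXiv:1202.6340): the objects of `Quot(T)` are the
`T/π^iT` (Def. 1.1.3, p. 5 L93–99), and at `v ∣ p` the module `T_𝔮` carries the ordinary filtration `Fil_v T_𝔮 = Fil_v T ⊗ S_𝔮`
(§3.1, p. 15 L56–62; Def. 3.2.5–3.2.6, p. 16), a direct summand compatible with every `Quot`-morphism.  In the tree the
`π`-adic levels of the curve's Eisenstein tower are `(E.eisensteinPiRefinementDatum κ hm).Level a` (`PiAdicRefinement`,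
`ZpExtensionEisensteinPiRefinementCurve`) with the two-index family `PiRefinementDatum.map a b` («reduce a lift, multiply by
`π^{b∸a}`», the eight identities `map_self/map_map_of_le/map_map_succ/map_injective/map_surjective/map_eq_zero_iff/map_map_smul/
pow_smul_level_eq_zero`), and their plus parts `E.piFil κ hm Φ a` (`ZpExtensionEisensteinH3OrdinaryProofs`: the image of
`Fil_v T^{(host a)} = A ⊗ Fil_v E[p^{host a}]`).  For the generic sub/quotient machinery of x10b-p1-w6 (`TowerPresentedSubquotientProofs`:
`exists_subFamily_apply_eq`, `exists_quotFamily_apply_mk` and the eight identities of the restricted / induced families) one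
needs exactly three module facts about `map` and `piFil`, proved here for an ordinary datum `Φ` whose transitions are onto on
`Fil_v E[p^k]` (`hFsurj`) and which admits adapted bases (`hbasis`; both hold for `ordinaryFiltrationAt` at a place of good
reduction with an ordinary point, `ZpExtensionEisensteinOrdinaryFilTransferProofs`, `TorsionFilAtAdaptedBasisProofs`):

* §1 the plus parts lift along the reductions of the datum (`exists_mem_twistedFil_red_eq`), so `piFil a` is presented from ANY
  level above its host (`proj_mem_piFil`, `exists_proj_eq_of_mem_piFil`);
* §2 **(map) `map_mem_piFil`**: every `map a b` carries `piFil a` into `piFil b`;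
* §3 **(ONTO) `exists_mem_piFil_map_eq`**: the reductions `map (ℓ+n) n` are onto `piFil n` from `piFil (ℓ+n)`;
* §4 **(SAT) `mem_piFil_of_map_mem`**: `map ℓ (ℓ+n) y ∈ piFil (ℓ+n) ⇒ y ∈ piFil ℓ` — with an adapted basis of `E[p^k]`
  (`Fil_v E[p^k]` a rank-one direct summand) the second coordinate of a lift `x` satisfies `[T]^n c ∈ ([T]^{ℓ+n})`, hence
  `c ∈ ([T]^ℓ)` (`mem_span_pow_of_pow_mul_mem`, principal Artinian of length `mk`), i.e. `x ∈ Fil + π^ℓ T^{(k)}`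
  (module form `Twisted.exists_mem_add_mkX_pow_smul_of_sub_mem_span`).

No summit statement is proved; BSD is not proved by any of this.

References: [Howard2004HeegnerKolyvagin] Def. 1.1.3, Rem. 1.1.4, §1.6, §3.1, Def. 3.2.5–3.2.6 (arXiv p. 5, p. 12, p. 15–16);
[GreenbergLNM1716] §2; [BourbakiAlgebre1a3] Ch. II §5 no. 1 Prop. 4.
-/

set_option autoImplicit false

noncomputable section

open Function Field IsDedekindDomain
open scoped TensorProduct Pointwise

/-! ## §0 Coordinates: `[T]^n x ∈ F + ([T]^{c+n}) W ⇒ x ∈ F + ([T]^c) W` -/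

namespace Literature.NumberTheory.EllipticCurves.IwasawaAlgebra.EisensteinCoeff.Twisted

open IwasawaAlgebra IwasawaAlgebra.EisensteinCoeff
open Literature.NumberTheory.GaloisCohomology.Howard2004

variable {p : ℕ} [hp : Fact p.Prime] {m k : ℕ} {M : Type} [AddCommGroup M]
  (e : M ≃+ (Fin 2 → ZMod (p ^ k))) (Fil : AddSubgroup M) (he : ∀ x : M, x ∈ Fil ↔ e x 1 = 0)

include he in
/-- **`[T]^n x − φ ∈ ([T]^{c+n}) · W` with `φ ∈ F` forces `x ∈ F + ([T]^c) · W`** (`c + n ≤ mk`, `k ≥ 1`), for the twisted plus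
part `F = span {d ⊗ a : a ∈ Fil}` of `W = M ⊗ A_{m,k}` and a basis of `M` adapted to `Fil` (a rank-one direct summand): the
second coordinate `c₁` of `x` has `[T]^n c₁ ∈ ([T]^{c+n})`, so `c₁ ∈ ([T]^c)` in the principal Artinian `A_{m,k}` of length `mk`.
[cite: Howard2004HeegnerKolyvagin, H.0, Rem. 1.1.4 and §3.1 (arXiv p. 7 L57, p. 5 L100–105, p. 15 L56–62)] [cite: GreenbergLNM1716, §2] -/
theorem exists_mem_add_mkX_pow_smul_of_sub_mem_span (hm : 1 ≤ m) (hk : 1 ≤ k) {c n : ℕ} (hcn : c + n ≤ m * k)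
    (x φ : Twisted p m k M)
    (hφ : φ ∈ Submodule.span ℤ {y : Twisted p m k M | ∃ (d : EisensteinCoeff p m k) (a : M), a ∈ Fil ∧ y = Twisted.tmul d a})
    (hx : (Ideal.Quotient.mk _ PowerSeries.X : EisensteinCoeff p m k) ^ n • x - φ ∈
      Ideal.span {(Ideal.Quotient.mk _ PowerSeries.X : EisensteinCoeff p m k) ^ (c + n)} • (⊤ : Submodule (EisensteinCoeff p m k)
        (Twisted p m k M))) :
    ∃ φ' ∈ Submodule.span ℤ {y : Twisted p m k M | ∃ (d : EisensteinCoeff p m k) (a : M), a ∈ Fil ∧ y = Twisted.tmul d a},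
      ∃ x' : Twisted p m k M, x = φ' + (Ideal.Quotient.mk _ PowerSeries.X : EisensteinCoeff p m k) ^ c • x' := by
  letI := isLocalRing_eisensteinCoeff p hm hk
  have hmax := maximalIdeal_eisensteinCoeff_eq p hm hk
  have hnil : (Ideal.Quotient.mk _ PowerSeries.X : EisensteinCoeff p m k) ^ (m * k) = 0 := mk_X_pow_mul_eq_zero m k
  have hnil' : m * k ≠ 0 → (Ideal.Quotient.mk _ PowerSeries.X : EisensteinCoeff p m k) ^ (m * k - 1) ≠ 0 :=
    fun _ ↦ mk_X_pow_ne_zero hm hk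
  set b := Twisted.basisOfAddEquiv (m := m) e with hb
  -- the second coordinates
  have hφ1 : b.repr φ 1 = 0 := (mem_twistedSpan_iff_repr_one_eq_zero e Fil he φ).mp hφ
  have hcoord : (Ideal.Quotient.mk _ PowerSeries.X : EisensteinCoeff p m k) ^ n * b.repr x 1 ∈
      Ideal.span {(Ideal.Quotient.mk _ PowerSeries.X : EisensteinCoeff p m k) ^ (c + n)} := by
    have h := (mem_smul_top_iff_forall_coord b _ _).mp hx 1
    rwa [map_sub, map_smul, Module.Basis.coord_apply, Module.Basis.coord_apply, hφ1, sub_zero, smul_eq_mul] at h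
  have hmem := mem_span_pow_of_pow_mul_mem hmax hnil hnil' hcn hcoord
  obtain ⟨d, hd⟩ := Ideal.mem_span_singleton'.mp hmem
  have hsum := b.sum_repr x
  rw [Fin.sum_univ_two] at hsum
  refine ⟨b.repr x 0 • b 0, ?_, d • b 1, ?_⟩
  · refine (mem_twistedSpan_iff_repr_one_eq_zero e Fil he _).mpr ?_
    rw [map_smul, Finsupp.smul_apply, b.repr_self, Finsupp.single_apply, if_neg zero_ne_one, smul_zero]
  · conv_lhs => rw [← hsum]
    rw [← hd, mul_comm, mul_smul]

end Literature.NumberTheory.EllipticCurves.IwasawaAlgebra.EisensteinCoeff.Twisted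

namespace WeierstrassCurve

open Literature.NumberTheory.EllipticCurves Literature.NumberTheory.GaloisRepresentations
open Literature.NumberTheory.GaloisRepresentations.DiscreteGaloisModule
open Literature.NumberTheory.EllipticCurves.ZpExtension (EisensteinLevel OrdinaryFiltration)
open Literature.NumberTheory.GaloisCohomology.Howard2004
open scoped NumberField

variable {K : Type} [Field K] [NumberField K] (E : WeierstrassCurve K) [E.IsElliptic] {p : ℕ} [hp : Fact p.Prime]
  (κ : Literature.NumberTheory.EllipticCurves.ZpExtension K p) {m : ℕ} (hm : 1 ≤ m) {v : HeightOneSpectrum (𝓞 K)}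
  (Φ : OrdinaryFiltration (fun j ↦ E.torsionGaloisModule ((p : ℤ) ^ j)) (fun j ↦ E.torsionGaloisModuleReduce p j) v)
  (hFsurj : ∀ (k : ℕ) (y : geomTorsion E ((p : ℤ) ^ k)), y ∈ Φ.fil k →
    ∃ y' ∈ Φ.fil (k + 1), E.torsionGaloisModuleReduce p k y' = y)

/-! ## §1 The plus parts lift along the reductions; `piFil` presented from any level -/

include hFsurj in
omit [E.IsElliptic] hp in
/-- `Fil_v E[p^{k'}] → Fil_v E[p^k]`, `P ↦ p^{k'-k} P`, is onto (the one-step surjectivity `hFsurj` iterated).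
[cite: Howard2004HeegnerKolyvagin, Def. 3.2.5–3.2.6 (arXiv p. 16: Fil_v T compatible with the tower)] [cite: GreenbergLNM1716, §2] -/
theorem exists_mem_fil_torsionGaloisModuleReduceLE_eq {k k' : ℕ} (h : k ≤ k') (a : geomTorsion E ((p : ℤ) ^ k))
    (ha : a ∈ Φ.fil k) : ∃ a' ∈ Φ.fil k', E.torsionGaloisModuleReduceLE p h a' = a := by
  obtain ⟨d, rfl⟩ := Nat.exists_eq_add_of_le h
  induction d with
  | zero => exact ⟨a, ha, E.torsionGaloisModuleReduceLE_refl p k a⟩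
  | succ d ih =>
    obtain ⟨a₁, ha₁, h₁⟩ := ih (Nat.le_add_right k d)
    obtain ⟨a₂, ha₂, h₂⟩ := hFsurj (k + d) a₁ ha₁
    refine ⟨a₂, ha₂, ?_⟩
    rw [E.torsionGaloisModuleReduceLE_trans p (Nat.le_add_right k d) (Nat.le_succ (k + d)), ← h₁]
    congr 1
    rw [E.torsionGaloisModuleReduceLE_succ]
    exact h₂

include hFsurj in
/-- **The twisted plus parts lift along the reductions of the datum**: every element of `Fil_v T^{(k)}` is the reduction of
an element of `Fil_v T^{(k')}` (`k ≤ k'`). [cite: Howard2004HeegnerKolyvagin, §3.1 and Def. 3.2.6 (arXiv p. 15 L56–62, p. 16)] [cite: GreenbergLNM1716, §2] -/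
theorem exists_mem_twistedFil_red_eq {k k' : ℕ} (h : k ≤ k')
    (x : IwasawaAlgebra.EisensteinCoeff.Twisted p m k (geomTorsion E ((p : ℤ) ^ k))) (hx : x ∈ Φ.twistedFil k) :
    ∃ y : EisensteinLevel p m (fun j ↦ geomTorsion E ((p : ℤ) ^ j)) k',
      (y : IwasawaAlgebra.EisensteinCoeff.Twisted p m k' (geomTorsion E ((p : ℤ) ^ k'))) ∈ Φ.twistedFil k' ∧
        (((E.eisensteinPiRefinementDatum κ hm).red h y : EisensteinLevel p m (fun j ↦ geomTorsion E ((p : ℤ) ^ j)) k) :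
          IwasawaAlgebra.EisensteinCoeff.Twisted p m k (geomTorsion E ((p : ℤ) ^ k))) = x := by
  have hred : ∀ (c : IwasawaAlgebra.EisensteinCoeff p m k') (a : geomTorsion E ((p : ℤ) ^ k')),
      (((E.eisensteinPiRefinementDatum κ hm).red h
          (IwasawaAlgebra.EisensteinCoeff.Twisted.tmul c a : EisensteinLevel p m (fun j ↦ geomTorsion E ((p : ℤ) ^ j)) k') :
            EisensteinLevel p m (fun j ↦ geomTorsion E ((p : ℤ) ^ j)) k) :
          IwasawaAlgebra.EisensteinCoeff.Twisted p m k (geomTorsion E ((p : ℤ) ^ k))) =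
        IwasawaAlgebra.EisensteinCoeff.Twisted.tmul (IwasawaAlgebra.EisensteinCoeff.reduce p m h c)
          (E.torsionGaloisModuleReduceLE p h a) := fun c a ↦ by
    rw [E.eisensteinPiRefinementDatum_red_apply]
    exact κ.eisensteinTwistReduce_tmul hm h (E.torsionGaloisModuleReduceLE p h) c a
  induction hx using Submodule.span_induction with
  | mem y hy =>
    obtain ⟨c, a, ha, rfl⟩ := hy
    obtain ⟨a', ha', haa⟩ := E.exists_mem_fil_torsionGaloisModuleReduceLE_eq Φ hFsurj h a ha
    obtain ⟨c', rfl⟩ := IwasawaAlgebra.EisensteinCoeff.reduce_surjective (p := p) m h c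
    exact ⟨IwasawaAlgebra.EisensteinCoeff.Twisted.tmul c' a', Φ.tmul_mem_twistedFil k' c' ha', by rw [hred, haa]⟩
  | zero => exact ⟨0, Submodule.zero_mem _, map_zero _⟩
  | add y z _ _ hy hz =>
    obtain ⟨y₁, hy₁, rfl⟩ := hy
    obtain ⟨z₁, hz₁, rfl⟩ := hz
    exact ⟨y₁ + z₁, Submodule.add_mem _ hy₁ hz₁, map_add _ _ _⟩
  | smul n y _ hy =>
    obtain ⟨y₁, hy₁, rfl⟩ := hy
    exact ⟨n • y₁, Submodule.smul_mem _ n hy₁, map_zsmul _ n _⟩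

/-- `proj` from ANY level above the host carries the twisted plus part into `piFil`.
[cite: Howard2004HeegnerKolyvagin, §3.1 and Def. 1.1.3 (arXiv p. 15 L56–62, p. 5 L93–99)] -/
theorem proj_mem_piFil {i k : ℕ} (h : (E.eisensteinPiRefinementDatum κ hm).host i ≤ k)
    {x : EisensteinLevel p m (fun j ↦ geomTorsion E ((p : ℤ) ^ j)) k}
    (hx : (x : IwasawaAlgebra.EisensteinCoeff.Twisted p m k (geomTorsion E ((p : ℤ) ^ k))) ∈ Φ.twistedFil k) :
    (E.eisensteinPiRefinementDatum κ hm).proj h x ∈ E.piFil κ hm Φ i := by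
  rw [PiRefinementDatum.proj_apply]
  exact (E.mem_piFil_iff κ hm Φ i _).mpr ⟨_, E.red_mem_twistedFil κ hm Φ h hx, rfl⟩

include hFsurj in
/-- Every element of `piFil i` is `proj x` for some `x ∈ Fil_v T^{(k)}`, for ANY level `k` above the host.
[cite: Howard2004HeegnerKolyvagin, §3.1 and Def. 1.1.3 (arXiv p. 15 L56–62, p. 5 L93–99)] -/
theorem exists_proj_eq_of_mem_piFil {i k : ℕ} (h : (E.eisensteinPiRefinementDatum κ hm).host i ≤ k)
    {y : (E.eisensteinPiRefinementDatum κ hm).Level i} (hy : y ∈ E.piFil κ hm Φ i) :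
    ∃ x : EisensteinLevel p m (fun j ↦ geomTorsion E ((p : ℤ) ^ j)) k,
      (x : IwasawaAlgebra.EisensteinCoeff.Twisted p m k (geomTorsion E ((p : ℤ) ^ k))) ∈ Φ.twistedFil k ∧
        (E.eisensteinPiRefinementDatum κ hm).proj h x = y := by
  obtain ⟨x₀, hx₀, rfl⟩ := (E.mem_piFil_iff κ hm Φ i y).mp hy
  obtain ⟨x, hx, hxx⟩ := E.exists_mem_twistedFil_red_eq κ hm Φ hFsurj h _ hx₀
  refine ⟨x, hx, ?_⟩
  rw [PiRefinementDatum.proj_apply]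
  exact congrArg Submodule.Quotient.mk hxx

/-- The `S_𝔮`-scalars preserve the twisted plus part (an `A_{m,k}`-submodule, `S_𝔮` acting through `A_{m,k}`).
[cite: Howard2004HeegnerKolyvagin, §3.1 (arXiv p. 15: Fil_v T_𝔮 is an S_𝔮-submodule)] -/
theorem pi_pow_smul_mem_twistedFil (k n : ℕ) {x : EisensteinLevel p m (fun j ↦ geomTorsion E ((p : ℤ) ^ j)) k}
    (hx : (x : IwasawaAlgebra.EisensteinCoeff.Twisted p m k (geomTorsion E ((p : ℤ) ^ k))) ∈ Φ.twistedFil k) :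
    (((E.eisensteinPiRefinementDatum κ hm).π ^ n • x : EisensteinLevel p m (fun j ↦ geomTorsion E ((p : ℤ) ^ j)) k) :
      IwasawaAlgebra.EisensteinCoeff.Twisted p m k (geomTorsion E ((p : ℤ) ^ k))) ∈ Φ.twistedFil k := by
  rw [E.eisensteinPiRefinementDatum_π, ← map_pow, ZpExtension.EisensteinLevel.quotient_mk_smul_def]
  exact Φ.smul_mem_twistedFil k _ hx

/-! ## §2 (map): every `map a b` carries `piFil a` into `piFil b` -/

include hFsurj in
/-- **(map)** `map a b (piFil a) ⊆ piFil b` for ALL `a`, `b` (reductions for `b ≤ a`, `×π^{b-a}` for `a ≤ b`).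
[cite: Howard2004HeegnerKolyvagin, Def. 1.1.3 and §3.1 (arXiv p. 5 L93–99, p. 15 L56–62)] [cite: GreenbergLNM1716, §2] -/
theorem map_mem_piFil (a b : ℕ) {y : (E.eisensteinPiRefinementDatum κ hm).Level a} (hy : y ∈ E.piFil κ hm Φ a) :
    (E.eisensteinPiRefinementDatum κ hm).map a b y ∈ E.piFil κ hm Φ b := by
  set D := E.eisensteinPiRefinementDatum κ hm with hD
  obtain ⟨x, hx, rfl⟩ := E.exists_proj_eq_of_mem_piFil κ hm Φ hFsurj (D.host_le_add_left a b) hy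
  rw [D.map_proj a b (D.host_le_add_left a b) (D.host_le_add_right a b), ← map_smul]
  exact E.proj_mem_piFil κ hm Φ _ (E.pi_pow_smul_mem_twistedFil κ hm Φ _ _ hx)

/-! ## §3 (ONTO): the reductions are onto on the plus parts -/

include hFsurj in
/-- **(ONTO)** every `y' ∈ piFil n` is `map (ℓ+n) n y` for some `y ∈ piFil (ℓ+n)`.
[cite: Howard2004HeegnerKolyvagin, Def. 3.2.6 and Lemma 3.2.7 (arXiv p. 16)] [cite: GreenbergLNM1716, §2 p. 82] -/
theorem exists_mem_piFil_map_eq (ℓ n : ℕ) {y' : (E.eisensteinPiRefinementDatum κ hm).Level n}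
    (hy' : y' ∈ E.piFil κ hm Φ n) :
    ∃ y ∈ E.piFil κ hm Φ (ℓ + n), (E.eisensteinPiRefinementDatum κ hm).map (ℓ + n) n y = y' := by
  set D := E.eisensteinPiRefinementDatum κ hm with hD
  have hn : D.host n ≤ D.host (ℓ + n) := D.host_mono (Nat.le_add_left n ℓ)
  obtain ⟨x, hx, rfl⟩ := E.exists_proj_eq_of_mem_piFil κ hm Φ hFsurj hn hy'
  refine ⟨D.proj le_rfl x, E.proj_mem_piFil κ hm Φ le_rfl hx, ?_⟩
  rw [D.map_proj (ℓ + n) n le_rfl hn, Nat.sub_eq_zero_of_le (Nat.le_add_left n ℓ), pow_zero, one_smul]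

/-! ## §4 (SAT): the plus parts are saturated along `×π^n` -/

include hFsurj in
/-- **(SAT)** `map ℓ (ℓ+n) y ∈ piFil (ℓ+n) ⇒ y ∈ piFil ℓ`, given adapted bases of the `E[p^k]` (`Fil_v E[p^k]` a rank-one
direct summand): with `x` a lift of `y` to the host `k` of `ℓ + n`, `π^n x ∈ Fil + π^{ℓ+n} T^{(k)}` forces `x ∈ Fil + π^ℓ T^{(k)}`
(§0), whose `proj` lies in `piFil ℓ`. [cite: Howard2004HeegnerKolyvagin, H.0, Rem. 1.1.4, Def. 1.1.3 and §3.1 (arXiv p. 5, p. 7, p. 15)]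
[cite: GreenbergLNM1716, §2] -/
theorem mem_piFil_of_map_mem
    (hbasis : ∀ k, 1 ≤ k → ∃ e : geomTorsion E ((p : ℤ) ^ k) ≃+ (Fin 2 → ZMod (p ^ k)), ∀ x, x ∈ Φ.fil k ↔ e x 1 = 0)
    (ℓ n : ℕ) (y : (E.eisensteinPiRefinementDatum κ hm).Level ℓ)
    (hy : (E.eisensteinPiRefinementDatum κ hm).map ℓ (ℓ + n) y ∈ E.piFil κ hm Φ (ℓ + n)) : y ∈ E.piFil κ hm Φ ℓ := by
  have hℓk : (E.eisensteinPiRefinementDatum κ hm).host ℓ ≤ (E.eisensteinPiRefinementDatum κ hm).host (ℓ + n) :=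
    (E.eisensteinPiRefinementDatum κ hm).host_mono (Nat.le_add_right ℓ n)
  obtain ⟨x, rfl⟩ := (E.eisensteinPiRefinementDatum κ hm).proj_surjective hℓk y
  -- the degenerate host `0`: the level `T^{(0)}` is zero
  rcases Nat.eq_zero_or_pos ((E.eisensteinPiRefinementDatum κ hm).host (ℓ + n)) with hk0 | hkpos
  · have hx0 : x = 0 := by
      have h := IwasawaAlgebra.EisensteinCoeff.prime_pow_nsmul_twisted (p := p) (m := m)
        (k := (E.eisensteinPiRefinementDatum κ hm).host (ℓ + n))
        (x : IwasawaAlgebra.EisensteinCoeff.Twisted p m _ (geomTorsion E ((p : ℤ) ^ _)))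
      have hpk : p ^ (E.eisensteinPiRefinementDatum κ hm).host (ℓ + n) = 1 := by rw [hk0, pow_zero]
      rw [hpk, one_smul] at h
      exact h
    rw [hx0, map_zero]
    exact Submodule.zero_mem _
  -- `π^n x ∈ Fil + π^{ℓ+n} T^{(k)}`, `k = host (ℓ+n)`
  have hmap : (E.eisensteinPiRefinementDatum κ hm).map ℓ (ℓ + n) ((E.eisensteinPiRefinementDatum κ hm).proj hℓk x) =
      (E.eisensteinPiRefinementDatum κ hm).proj le_rfl ((E.eisensteinPiRefinementDatum κ hm).π ^ n • x) := by
    rw [(E.eisensteinPiRefinementDatum κ hm).map_proj ℓ (ℓ + n) hℓk le_rfl, Nat.add_sub_cancel_left, map_smul]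
  rw [hmap] at hy
  obtain ⟨x', hx', hxx'⟩ := E.exists_proj_eq_of_mem_piFil κ hm Φ hFsurj le_rfl hy
  have hker : (E.eisensteinPiRefinementDatum κ hm).π ^ n • x - x' ∈
      (E.eisensteinPiRefinementDatum κ hm).piPow ((E.eisensteinPiRefinementDatum κ hm).host (ℓ + n)) (ℓ + n) := by
    rw [← (E.eisensteinPiRefinementDatum κ hm).ker_proj (le_refl _), LinearMap.mem_ker, map_sub, hxx', sub_self]
  -- read the `S_𝔮`-statement over `A_{m,k}`
  letI := IwasawaAlgebra.EisensteinCoeff.algebraOfSpec p m ((E.eisensteinPiRefinementDatum κ hm).host (ℓ + n))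
  haveI := ZpExtension.EisensteinLevel.isScalarTower_algebraOfSpec p m (fun j ↦ geomTorsion E ((p : ℤ) ^ j))
    ((E.eisensteinPiRefinementDatum κ hm).host (ℓ + n))
  have hπA : algebraMap _ (IwasawaAlgebra.EisensteinCoeff p m ((E.eisensteinPiRefinementDatum κ hm).host (ℓ + n)))
      (E.eisensteinPiRefinementDatum κ hm).π =
      (Ideal.Quotient.mk _ PowerSeries.X :
        IwasawaAlgebra.EisensteinCoeff p m ((E.eisensteinPiRefinementDatum κ hm).host (ℓ + n))) := by
    rw [E.eisensteinPiRefinementDatum_π]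
    exact IwasawaAlgebra.EisensteinCoeff.ofSpec_mk p m _ PowerSeries.X
  have hπpow : ∀ (j : ℕ) (z : EisensteinLevel p m (fun j ↦ geomTorsion E ((p : ℤ) ^ j))
      ((E.eisensteinPiRefinementDatum κ hm).host (ℓ + n))),
      (E.eisensteinPiRefinementDatum κ hm).π ^ j • z =
        (Ideal.Quotient.mk _ PowerSeries.X :
          IwasawaAlgebra.EisensteinCoeff p m ((E.eisensteinPiRefinementDatum κ hm).host (ℓ + n))) ^ j • z := by
    intro j z
    have hπj : (E.eisensteinPiRefinementDatum κ hm).π ^ j = Ideal.Quotient.mk _ (PowerSeries.X ^ j) := by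
      rw [E.eisensteinPiRefinementDatum_π]
      exact (RingHom.map_pow _ _ _).symm
    rw [hπj, ZpExtension.EisensteinLevel.quotient_mk_smul_def,
      RingHom.map_pow (Ideal.Quotient.mk _) PowerSeries.X j]
  have hsmul : ((E.eisensteinPiRefinementDatum κ hm).π ^ n • x :
        EisensteinLevel p m (fun j ↦ geomTorsion E ((p : ℤ) ^ j)) ((E.eisensteinPiRefinementDatum κ hm).host (ℓ + n))) =
      (Ideal.Quotient.mk _ PowerSeries.X :
        IwasawaAlgebra.EisensteinCoeff p m ((E.eisensteinPiRefinementDatum κ hm).host (ℓ + n))) ^ n • x := hπpow n x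
  have hkerA : (Ideal.Quotient.mk _ PowerSeries.X :
          IwasawaAlgebra.EisensteinCoeff p m ((E.eisensteinPiRefinementDatum κ hm).host (ℓ + n))) ^ n •
        (x : IwasawaAlgebra.EisensteinCoeff.Twisted p m _ (geomTorsion E ((p : ℤ) ^ _))) - x' ∈
      Ideal.span {(Ideal.Quotient.mk _ PowerSeries.X :
          IwasawaAlgebra.EisensteinCoeff p m ((E.eisensteinPiRefinementDatum κ hm).host (ℓ + n))) ^ (ℓ + n)} •
        (⊤ : Submodule (IwasawaAlgebra.EisensteinCoeff p m ((E.eisensteinPiRefinementDatum κ hm).host (ℓ + n)))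
          (IwasawaAlgebra.EisensteinCoeff.Twisted p m _ (geomTorsion E ((p : ℤ) ^ _)))) := by
    have h := (mem_span_singleton_smul_top_iff_of_isScalarTower
      (A := IwasawaAlgebra.EisensteinCoeff p m ((E.eisensteinPiRefinementDatum κ hm).host (ℓ + n)))
      ((E.eisensteinPiRefinementDatum κ hm).π ^ (ℓ + n)) ((E.eisensteinPiRefinementDatum κ hm).π ^ n • x - x')).mp hker
    have hπAℓ : algebraMap _ (IwasawaAlgebra.EisensteinCoeff p m ((E.eisensteinPiRefinementDatum κ hm).host (ℓ + n)))
        ((E.eisensteinPiRefinementDatum κ hm).π ^ (ℓ + n)) =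
        (Ideal.Quotient.mk _ PowerSeries.X :
          IwasawaAlgebra.EisensteinCoeff p m ((E.eisensteinPiRefinementDatum κ hm).host (ℓ + n))) ^ (ℓ + n) := by
      rw [RingHom.map_pow (algebraMap _ _) _ (ℓ + n), hπA]
    rw [hπAℓ, hsmul] at h
    exact h
  obtain ⟨e, he⟩ := hbasis _ hkpos
  have hcn : ℓ + n ≤ m * (E.eisensteinPiRefinementDatum κ hm).host (ℓ + n) := by
    have := (E.eisensteinPiRefinementDatum κ hm).le_e_host (ℓ + n)
    rw [E.eisensteinPiRefinementDatum_e] at this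
    exact this
  obtain ⟨φ', hφ', x'', hxeq⟩ :=
    IwasawaAlgebra.EisensteinCoeff.Twisted.exists_mem_add_mkX_pow_smul_of_sub_mem_span e
      (Φ.fil ((E.eisensteinPiRefinementDatum κ hm).host (ℓ + n))).toAddSubgroup (fun z ↦ he z) hm hkpos hcn _ _ hx' hkerA
  -- `proj_ℓ x = proj_ℓ φ' ∈ piFil ℓ`
  have hx'' : (E.eisensteinPiRefinementDatum κ hm).proj hℓk
      (((Ideal.Quotient.mk _ PowerSeries.X :
          IwasawaAlgebra.EisensteinCoeff p m ((E.eisensteinPiRefinementDatum κ hm).host (ℓ + n))) ^ ℓ • x'' :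
        IwasawaAlgebra.EisensteinCoeff.Twisted p m _ (geomTorsion E ((p : ℤ) ^ _))) :
          EisensteinLevel p m (fun j ↦ geomTorsion E ((p : ℤ) ^ j)) ((E.eisensteinPiRefinementDatum κ hm).host (ℓ + n))) = 0 := by
    rw [← LinearMap.mem_ker, (E.eisensteinPiRefinementDatum κ hm).ker_proj hℓk]
    have hmem : (E.eisensteinPiRefinementDatum κ hm).π ^ ℓ •
        (ZpExtension.EisensteinLevel.equivTwisted ((E.eisensteinPiRefinementDatum κ hm).host (ℓ + n))).symm x'' ∈
        (E.eisensteinPiRefinementDatum κ hm).piPow ((E.eisensteinPiRefinementDatum κ hm).host (ℓ + n)) ℓ :=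
      Submodule.smul_mem_smul (Ideal.mem_span_singleton_self _) Submodule.mem_top
    rw [hπpow ℓ] at hmem
    exact hmem
  have hproj : (E.eisensteinPiRefinementDatum κ hm).proj hℓk x =
      (E.eisensteinPiRefinementDatum κ hm).proj hℓk
          (φ' : EisensteinLevel p m (fun j ↦ geomTorsion E ((p : ℤ) ^ j)) ((E.eisensteinPiRefinementDatum κ hm).host (ℓ + n))) +
        (E.eisensteinPiRefinementDatum κ hm).proj hℓk
          (((Ideal.Quotient.mk _ PowerSeries.X :
              IwasawaAlgebra.EisensteinCoeff p m ((E.eisensteinPiRefinementDatum κ hm).host (ℓ + n))) ^ ℓ • x'' :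
            IwasawaAlgebra.EisensteinCoeff.Twisted p m _ (geomTorsion E ((p : ℤ) ^ _))) :
              EisensteinLevel p m (fun j ↦ geomTorsion E ((p : ℤ) ^ j)) ((E.eisensteinPiRefinementDatum κ hm).host (ℓ + n))) := by
    rw [← map_add]
    exact congrArg ((E.eisensteinPiRefinementDatum κ hm).proj hℓk) hxeq
  rw [hproj, hx'', add_zero]
  exact E.proj_mem_piFil κ hm Φ hℓk hφ'

end WeierstrassCurve

end
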